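import Literature.NumberTheory.LFunctions.XiJensenRows
import Mathlib.Analysis.Analytic.Order
import HarnessLib

/-!
# A hyperbolic row of the Jensen grid of `ξ` bounds the multiplicity of the off-line zeros of `ξ`

RH-FREE (line 1, cell rh-jensen discipline; bears_on LADDER-RH J-P(P3), the complement region
`n < c·d³` of route `route-RiemannHypothesis-JensenPolynomials`): every theorem below is an
implication between statements about `ξ` none of which is known; nothing here bears on the truth
of RH, and no row of the Jensen grid is claimed hyperbolic.

With `γ = xiTaylorCoeff`, `J^{d,n}_γ = jensenPoly xiTaylorCoeff d n`, `ξ(s) = ξ₁((s-½)²)`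
(`ξ₁ = xiSq`, tree `riemannXi_eq_xiSq`) and the row dictionary of
`Literature/NumberTheory/LFunctions/XiJensenRows.lean` (`XiRowHyperbolic n ↔ XiDerivZerosReal n`:
row `n` hyperbolic in every degree iff `ξ₁⁽ⁿ⁾` has only real zeros):

* `analyticOrderAt_riemannXi_eq` — `s ↦ (s-½)²` is conformal at `s ≠ ½`, so
  `ord_s ξ = ord_{(s-½)²} ξ₁`; `iteratedDeriv_xiSq_eq_zero_of_riemannXi_vanishing` — persistence:
  if `ξ` vanishes to order `≥ m` at `s ≠ ½` then `ξ₁, …, ξ₁⁽ᵐ⁻¹⁾` vanish at `(s-½)²`;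
  `sq_im_ne_zero_of_riemannXi_eq_zero_offLine` — an off-line zero `s` gives a NON-REAL `(s-½)²`
  (`ζ` has no zeros on `(0,1)`).
* `exists_iteratedDeriv_riemannXi_ne_zero_of_xiDerivZerosReal` /
  `exists_iteratedDeriv_riemannXi_ne_zero_of_xiRowHyperbolic` — **row `n` hyperbolic in every
  degree ⇒ every zero of `ξ` off the critical line has multiplicity `≤ n`** (some derivative of
  order `≤ n` does not vanish there). For `n = 0` this is Pólya's hard half (RH,
  `riemannHypothesis_iff_xiRowHyperbolic_zero`); for `n = 1`,
  `deriv_riemannXi_ne_zero_of_rows_ge_one`: hyperbolicity of all `J^{d,n}_γ` with `n ≥ 1` — the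
  premise of Farmer's "no information" discussion [Farmer2022, §2] — forces every MULTIPLE zero of
  `ξ` onto the critical line. This is the exact residue of arithmetic information carried by the
  rows `n ≥ 1`; the class witnesses of `Literature/Barriers/RiemannHypothesis/JensenPolynomials{Cone,
  Kim,Sqrt}.lean` have simple non-real zeros, so they cannot destroy it.
* Glue with the effective shapes of the cell's log-band programme, hypotheses INLINED (no
  conjecture-shaped definition is introduced): `exp_le_norm_sq_of_derivZeros_realification` — a
  realification window `{ξ₁⁽ⁿ⁾ = 0, non-real} ⊂ {‖w‖ ≥ e^{cn}}` for `n ≥ n₁` gives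
  `e^{c(m-1)} ≤ |s-½|²` at an off-line zero of multiplicity `≥ m ≥ n₁+1`;
  `exists_iteratedDeriv_riemannXi_ne_zero_of_band_of_detection` — a `(d,n)`-uniform mechanism on a
  band `n ≥ N₁(d)` plus row-uniform detection at degree `D(w)` gives `ord_ξ(s) ≤ N₁(D((s-½)²))`;
  `…_of_logBand_of_detection` — the logarithmic band `d + 1 ≤ e^{cn}` in closed form,
  `ord_ξ(s) ≤ max n₁ ⌈log(D+1)/c⌉`.

Provenance: cell rh-jensen (D-0074 GROUP I, negation lens round 4, `NegationLensR4Sketch.lean`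
§§4–5 of planner-rh-jensen-idea-2-g4-0, 2026-08-26; the law-grade part of the memo
NEGATION-LENS-R4.md — drift / footprint / shore numbers — is NOT formalised), landed by
prover-rh-jensen-eng-2-g4-0 (idea-2 g4 WANTED W3) as a helper file of the route's assembly item.
AI-produced formalisation; AI review is weaker than expert review.

References: [Farmer2022] D. W. Farmer, Adv. Math. 411 (2022), §2; [CravenCsordas1989] T. Craven,
G. Csordas, Pacific J. Math. 136 (1989), §1 (i); [Titchmarsh1986] §2.12.
-/

open Polynomial Complex Filter Topology Set
open scoped ComplexConjugate Nat

set_option linter.dupNamespace false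

namespace Summit.RiemannHypothesis.RiemannHypothesis.Theorems.JensenPolynomials.XiRows

open Literature.NumberTheory.LFunctions Literature.Analysis.Complex.PolyaSchur

/-! ## Persistence through `s ↦ (s-½)²` -/

/-- `s ↦ (s-½)²` is conformal at `s ≠ ½`, so `ord_s ξ = ord_{(s-½)²} ξ₁` (Mathlib
`analyticOrderAt_comp_of_deriv_ne_zero` with `riemannXi_eq_xiSq`). -/
theorem analyticOrderAt_riemannXi_eq {s : ℂ} (hs : s ≠ 1 / 2) :
    analyticOrderAt riemannXi s = analyticOrderAt xiSq ((s - 1 / 2) ^ 2) := by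
  have hcomp : riemannXi = xiSq ∘ fun s : ℂ => (s - 1 / 2) ^ 2 :=
    funext fun s => riemannXi_eq_xiSq s
  have hg : AnalyticAt ℂ (fun s : ℂ => (s - 1 / 2) ^ 2) s := by fun_prop
  have hd : HasDerivAt (fun s : ℂ => (s - 1 / 2) ^ 2) (2 * (s - 1 / 2)) s := by
    simpa using ((hasDerivAt_id s).sub_const (1 / 2 : ℂ)).fun_pow 2
  have hg' : deriv (fun s : ℂ => (s - 1 / 2) ^ 2) s ≠ 0 := by
    rw [hd.deriv]
    exact mul_ne_zero two_ne_zero (sub_ne_zero.2 hs)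
  rw [hcomp]
  exact analyticOrderAt_comp_of_deriv_ne_zero hg hg'

/-- A zero `s` of `ξ` with `(s-½)²` real lies on the critical line: otherwise `Im s = 0` and `s`
would be a real zero of `ζ` in `(0, 1)` (tree `riemannZeta_ne_zero_of_im_eq_zero_of_pos_of_lt_one`,
[Titchmarsh1986, §2.12]). -/
theorem re_eq_half_of_riemannXi_eq_zero_of_sq_im_eq_zero {s : ℂ} (hξ : riemannXi s = 0)
    (him : ((s - 1 / 2) ^ 2).im = 0) : s.re = 1 / 2 := by
  obtain ⟨hζ, h0, h1⟩ := (riemannXi_eq_zero_iff_holds s).1 hξ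
  have hmul : (s.re - 1 / 2) * s.im = 0 := by
    simp only [sq, Complex.mul_im, Complex.sub_re, Complex.div_ofNat_re, Complex.one_re,
      Complex.sub_im, Complex.div_ofNat_im, Complex.one_im] at him
    nlinarith [him]
  rcases mul_eq_zero.1 hmul with hre | him0
  · linarith
  · exact absurd hζ (riemannZeta_ne_zero_of_im_eq_zero_of_pos_of_lt_one him0 h0 h1)

/-- An off-line zero `s` of `ξ` gives a NON-REAL zero `w₀ = (s-½)²` of `ξ₁`. -/
theorem sq_im_ne_zero_of_riemannXi_eq_zero_offLine {s : ℂ} (hξ : riemannXi s = 0)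
    (hre : s.re ≠ 1 / 2) : ((s - 1 / 2) ^ 2).im ≠ 0 :=
  fun him => hre (re_eq_half_of_riemannXi_eq_zero_of_sq_im_eq_zero hξ him)

/-- **Persistence at the `ξ₁` level:** if `ξ` vanishes to order `≥ m` at `s ≠ ½` (all derivatives of
order `< m` vanish) then `ξ₁, ξ₁', …, ξ₁⁽ᵐ⁻¹⁾` all vanish at `(s-½)²`. -/
theorem iteratedDeriv_xiSq_eq_zero_of_riemannXi_vanishing {s : ℂ} (hs : s ≠ 1 / 2) {m : ℕ}
    (hvan : ∀ i, i < m → iteratedDeriv i riemannXi s = 0) :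
    ∀ i, i < m → iteratedDeriv i xiSq ((s - 1 / 2) ^ 2) = 0 := by
  have hord : ((m : ℕ) : ℕ∞) ≤ analyticOrderAt riemannXi s := by
    rw [natCast_le_analyticOrderAt_iff_iteratedDeriv_eq_zero (differentiable_riemannXi.analyticAt s)]
    exact hvan
  rwa [analyticOrderAt_riemannXi_eq hs,
    natCast_le_analyticOrderAt_iff_iteratedDeriv_eq_zero (differentiable_xiSq.analyticAt _)] at hord

/-! ## Multiplicity: the information a hyperbolic row carries about `ζ` -/

/-- **`ξ₁⁽ⁿ⁾` has only real zeros ⇒ every zero of `ξ` off the critical line has multiplicity `≤ n`**: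
some derivative `ξ⁽ⁱ⁾`, `i ≤ n`, does not vanish there (persistence: a zero of `ξ` of multiplicity
`> n` at `s`, `Re s ≠ ½`, is a non-real zero of `ξ₁⁽ⁿ⁾`). RH-FREE implication. -/
theorem exists_iteratedDeriv_riemannXi_ne_zero_of_xiDerivZerosReal {n : ℕ}
    (h : XiDerivZerosReal n) {s : ℂ} (hξ : riemannXi s = 0) (hre : s.re ≠ 1 / 2) :
    ∃ i, i ≤ n ∧ iteratedDeriv i riemannXi s ≠ 0 := by
  by_contra hcon
  push Not at hcon
  have hs : s ≠ 1 / 2 := by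
    rintro rfl
    exact hre (by norm_num)
  have hw : iteratedDeriv n xiSq ((s - 1 / 2) ^ 2) = 0 :=
    iteratedDeriv_xiSq_eq_zero_of_riemannXi_vanishing hs (m := n + 1)
      (fun i hi => hcon i (Nat.lt_succ_iff.1 hi)) n (Nat.lt_succ_self n)
  exact sq_im_ne_zero_of_riemannXi_eq_zero_offLine hξ hre (h _ hw)

/-- **ROW `n` HYPERBOLIC IN EVERY DEGREE ⇒ EVERY ZERO OF `ξ` OFF THE CRITICAL LINE HAS
MULTIPLICITY `≤ n`** (some `ξ⁽ⁱ⁾(s) ≠ 0`, `i ≤ n`). For `n = 0` this is Pólya's hard half (RH,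
`riemannHypothesis_iff_xiRowHyperbolic_zero`); for `n ≥ 1` it is the exact residue of arithmetic
information carried by the rows `n ≥ 1`. RH-FREE implication; neither side is known.
(Craven–Csordas §1 (i) for the dictionary; Farmer 2022 §2 for the premise.) -/
theorem exists_iteratedDeriv_riemannXi_ne_zero_of_xiRowHyperbolic {n : ℕ} (h : XiRowHyperbolic n)
    {s : ℂ} (hξ : riemannXi s = 0) (hre : s.re ≠ 1 / 2) :
    ∃ i, i ≤ n ∧ iteratedDeriv i riemannXi s ≠ 0 :=
  exists_iteratedDeriv_riemannXi_ne_zero_of_xiDerivZerosReal (xiDerivZerosReal_of_xiRowHyperbolic h)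
    hξ hre

/-- **`n = 1`:** the premise "all `J^{d,n}_γ` with `n ≥ 1` are hyperbolic" (Farmer 2022, §2) forces
every multiple zero of `ξ` (equivalently, every multiple non-trivial zero of `ζ`) onto the critical
line: `ξ(s) = 0`, `Re s ≠ ½` ⇒ `ξ'(s) ≠ 0`. RH-FREE implication. -/
theorem deriv_riemannXi_ne_zero_of_rows_ge_one
    (h : ∀ d n : ℕ, 1 ≤ n → (jensenPoly xiTaylorCoeff d n).Splits) {s : ℂ}
    (hξ : riemannXi s = 0) (hre : s.re ≠ 1 / 2) : deriv riemannXi s ≠ 0 := by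
  obtain ⟨i, hi, hne⟩ :=
    exists_iteratedDeriv_riemannXi_ne_zero_of_xiRowHyperbolic (n := 1) (fun d => h d 1 le_rfl) hξ hre
  interval_cases i
  · exact absurd (by simpa using hξ) hne
  · simpa [iteratedDeriv_one] using hne

/-- Up-set form: if SOME row `n₀ ≤ n` is hyperbolic in every degree then the off-line zeros of `ξ`
have multiplicity `≤ n` (`xiRowHyperbolic_mono`). RH-FREE implication. -/
theorem exists_iteratedDeriv_riemannXi_ne_zero_of_xiRowHyperbolic_le {n₀ n : ℕ} (hle : n₀ ≤ n)
    (h : XiRowHyperbolic n₀) {s : ℂ} (hξ : riemannXi s = 0) (hre : s.re ≠ 1 / 2) :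
    ∃ i, i ≤ n ∧ iteratedDeriv i riemannXi s ≠ 0 :=
  exists_iteratedDeriv_riemannXi_ne_zero_of_xiRowHyperbolic (xiRowHyperbolic_mono hle h) hξ hre

/-! ## Glue with effective shapes (hypotheses inlined; no conjecture-shaped definition) -/

/-- **Realification window ⇒ off-line multiplicity bound.** If for every `n ≥ n₁` each non-real zero
of `ξ₁⁽ⁿ⁾` has modulus `≥ e^{cn}` (a "realification window", stated inline), then a zero `s` of `ξ`
off the critical line at which `ξ` vanishes to order `≥ m`, `m ≥ n₁ + 1`, satisfies
`e^{c(m-1)} ≤ ‖(s-½)²‖ = |s-½|²`, i.e. `m ≤ 1 + 2·log|s-½|/c`. RH-FREE implication. -/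
theorem exp_le_norm_sq_of_derivZeros_realification {c : ℝ} {n₁ : ℕ}
    (h : ∀ n : ℕ, n₁ ≤ n → ∀ z : ℂ, iteratedDeriv n xiSq z = 0 → z.im ≠ 0 →
      Real.exp (c * (n : ℝ)) ≤ ‖z‖)
    {s : ℂ} (hξ : riemannXi s = 0) (hre : s.re ≠ 1 / 2) {m : ℕ} (hm : n₁ + 1 ≤ m)
    (hvan : ∀ i, i < m → iteratedDeriv i riemannXi s = 0) :
    Real.exp (c * ((m - 1 : ℕ) : ℝ)) ≤ ‖(s - 1 / 2) ^ 2‖ := by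
  have hs : s ≠ 1 / 2 := by rintro rfl; exact hre (by norm_num)
  have hG := iteratedDeriv_xiSq_eq_zero_of_riemannXi_vanishing hs hvan (m - 1) (by omega)
  exact h (m - 1) (by omega) _ hG (sq_im_ne_zero_of_riemannXi_eq_zero_offLine hξ hre)

/-- **Band + detection ⇒ effective multiplicity bound.** A `(d,n)`-uniform hyperbolicity mechanism
on a band `n ≥ N₁(d)` together with row-uniform detection (a non-real zero `w` of `ξ₁⁽ᵏ⁾` makes
`J^{d,k}_γ` non-hyperbolic for all `d ≥ D(w)`; both stated inline) bounds the order of vanishing of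
`ξ` at every zero `s` off the critical line: `ord_ξ(s) ≤ N₁(D((s-½)²))`. RH-FREE implication. -/
theorem exists_iteratedDeriv_riemannXi_ne_zero_of_band_of_detection {N₁ : ℕ → ℕ} {D : ℂ → ℕ}
    (hB : ∀ d n : ℕ, N₁ d ≤ n → (jensenPoly xiTaylorCoeff d n).Splits)
    (hD : ∀ k : ℕ, ∀ w : ℂ, iteratedDeriv k xiSq w = 0 → w.im ≠ 0 →
      ∀ d : ℕ, D w ≤ d → ¬ (jensenPoly xiTaylorCoeff d k).Splits)
    {s : ℂ} (hξ : riemannXi s = 0) (hre : s.re ≠ 1 / 2) :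
    ∃ i, i ≤ N₁ (D ((s - 1 / 2) ^ 2)) ∧ iteratedDeriv i riemannXi s ≠ 0 := by
  by_contra hcon
  push Not at hcon
  have hs : s ≠ 1 / 2 := by rintro rfl; exact hre (by norm_num)
  set w : ℂ := (s - 1 / 2) ^ 2 with hw
  set N : ℕ := N₁ (D w) with hN
  have hG : iteratedDeriv N xiSq w = 0 :=
    iteratedDeriv_xiSq_eq_zero_of_riemannXi_vanishing hs (m := N + 1)
      (fun i hi => hcon i (Nat.lt_succ_iff.1 hi)) N (Nat.lt_succ_self N)
  exact hD N w hG (sq_im_ne_zero_of_riemannXi_eq_zero_offLine hξ hre) (D w) le_rfl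
    (hB (D w) N le_rfl)

/-- **Log band at rate `c` + detection at degree `D` ⇒ `ord_ξ(s) ≤ max n₁ ⌈log(D+1)/c⌉`** (the
multiplicity content of a logarithmic band `n ≥ n₁`, `d + 1 ≤ e^{cn}`, in closed form; hypotheses
inline). RH-FREE implication. -/
theorem exists_iteratedDeriv_riemannXi_ne_zero_of_logBand_of_detection {c : ℝ} (hc : 0 < c)
    {n₁ : ℕ} {D : ℂ → ℕ}
    (hB : ∀ d n : ℕ, n₁ ≤ n → (d : ℝ) + 1 ≤ Real.exp (c * (n : ℝ)) →
      (jensenPoly xiTaylorCoeff d n).Splits)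
    (hD : ∀ k : ℕ, ∀ w : ℂ, iteratedDeriv k xiSq w = 0 → w.im ≠ 0 →
      ∀ d : ℕ, D w ≤ d → ¬ (jensenPoly xiTaylorCoeff d k).Splits)
    {s : ℂ} (hξ : riemannXi s = 0) (hre : s.re ≠ 1 / 2) :
    ∃ i, i ≤ max n₁ ⌈Real.log ((D ((s - 1 / 2) ^ 2) : ℝ) + 1) / c⌉₊ ∧
      iteratedDeriv i riemannXi s ≠ 0 := by
  -- the log band is a band mechanism with `N₁(d) = max n₁ ⌈log(d+1)/c⌉₊`
  have hband : ∀ d n : ℕ, max n₁ ⌈Real.log ((d : ℝ) + 1) / c⌉₊ ≤ n →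
      (jensenPoly xiTaylorCoeff d n).Splits := by
    intro d n hn
    refine hB d n (le_trans (le_max_left _ _) hn) ?_
    have h2 : ⌈Real.log ((d : ℝ) + 1) / c⌉₊ ≤ n := le_trans (le_max_right _ _) hn
    have h3 : Real.log ((d : ℝ) + 1) / c ≤ n := le_trans (Nat.le_ceil _) (by exact_mod_cast h2)
    have h4 : Real.log ((d : ℝ) + 1) ≤ c * n := by rwa [div_le_iff₀ hc, mul_comm] at h3
    calc ((d : ℝ) + 1) = Real.exp (Real.log ((d : ℝ) + 1)) := by
          rw [Real.exp_log (by positivity)]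
      _ ≤ Real.exp (c * n) := Real.exp_le_exp.2 h4
  exact exists_iteratedDeriv_riemannXi_ne_zero_of_band_of_detection
    (N₁ := fun d => max n₁ ⌈Real.log ((d : ℝ) + 1) / c⌉₊) hband hD hξ hre

end Summit.RiemannHypothesis.RiemannHypothesis.Theorems.JensenPolynomials.XiRows
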